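import Summits.BirchSwinnertonDyer.BirchSwinnertonDyer.Theorems.ResidualThetaTransportAtTwoSignedMuVanishingAtTwoPlusCuspSpanFlat
import HarnessLib

/-!
# Route `ResidualThetaTransportAtTwo`, crux Kμ⁺ `SignedMuVanishingAtTwoPlus` (stmt-BirchSwinnertonDyer-20689),
# line `birth`, stub `stub_flatMuZeroAtTwo`: THEOREM (R) with its MINIMAL hypothesis — the `T₂`-kernel form (G″)_N
# («no non-zero `T₂`-killed class of `H¹(X₀(N); 𝔽₂)` vanishes on all the loops `{0 → b/4^k}`»), weaker than (G′)_N

Cell `bsd-wall`, lead `bsd-wall-rtt-p4` g5 (helper; THEOREMS ONLY — no `def`, no named fact, no `sorry`; (G″)_N and (G′)_N are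
HYPOTHESES spelled inline; BSD is not proved by this). Sequel of `…CuspSpanHeckeShimura` / `…CuspSpanHecke` / `…CuspSpanFlat`
(p592546 / p592862 / p593268).

The proof of Theorem (R) only ever applies the spanning hypothesis to ONE character, the mod-2 plus character `χ_f` of the
newform, which is KILLED by `T₂` (`a₂ = 0`): for every Hecke-translate family `δ₀, δ₁, δ'` of `γ` (`{∞,γ∞}_{T₂h} = ∑ⱼ{∞,δⱼ∞}_h +
{∞,δ'∞}_h` for all `h`), `χ_f(δ₀) + χ_f(δ₁) + χ_f(δ') = a₂·χ_f(γ) = 0`. So the minimal curve-free hypothesis is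

  (G″)_N: every additive `χ : Γ₀(N) → ZMod 2` through the period homology which is `T₂`-killed (the displayed sum vanishes for
  every `γ` and every translate family) and kills every `γ` with `|d(γ)| = 4^k`, `k ≥ 1`, is identically `0`

— in homology: `V^even_N + T₂ H₁(X₀(N); 𝔽₂) = H₁(X₀(N); 𝔽₂)`. This file proves:
* §1 `exists_odd_re_cuspSymbol_of_heckeKernelSpan`: (G″)_N ∧ `Ω⁺_f ≠ 0` ∧ `T₂ f = a f` with `a` EVEN ⟹ some `γ` with `|d(γ)| = 4^k`
  has `2 re{∞,γ∞}_f/Ω⁺_f` odd (no Hecke–Shimura lemma needed);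
* §2 `heckeKernelSpan_of_cuspSpan`: (G′)_N ⟹ (G″)_N for odd `N` (by the Hecke–Shimura lemma at `p = 2`: `ψ(d(γ)³) = ψ(d(γ))`, so a
  `T₂`-killed `ψ∘d` vanishes) — the landed (G′)-theorems are COROLLARIES of the (G″)-theorems;
* §3 `flatAtTwo_of_heckeKernelSpan` (habitat⁺: `IsNewformOf W f`, `GoodSS W 2`, `a₂(W) = 0`): **(G″)_{N_W} ⟹ `2 ∤ L♭` for every
  Pollack pair of `f` at `2`**; `flatMuZeroAtTwo_of_heckeKernelSpan`: (G″)_N for all odd `N` ⟹ the registered stub `FlatMuZeroAtTwo`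
  (verbatim).
(G″)_N is verified wherever (G′)_N is (§2): all odd `N ≤ 2999` with `g ≥ 1`, habitat⁺ conductors 11475, 14157, 35131, 42085, 50745
(lead g4; 11475 re-verified independently by lead g5); open for infinite families.

References: J. E. Cremona, *Algorithms for modular elliptic curves* (1997) §2.4, §2.8 [CremonaAlgorithms1997]; R. Pollack, Duke Math.
J. 118 (2003) Conj. 6.3, Prop. 6.18 [Pollack2003]; B. Mazur, Publ. IHÉS 47 (1977) §II.11 [Mazur1977].
-/

set_option autoImplicit false
set_option linter.dupNamespace false

noncomputable section

open scoped Classical MatrixGroups ModularForm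

open CongruenceSubgroup WeierstrassCurve Literature.NumberTheory.EllipticCurves
  Literature.NumberTheory.EllipticCurves.ModularForms Literature.NumberTheory.EllipticCurves.Rank1Residual
  Literature.NumberTheory.IwasawaTheory Summit.BirchSwinnertonDyer.Rank1Residual.Supersingular
  Summit.BirchSwinnertonDyer.BirchSwinnertonDyer.Theses.ResidualThetaTransportAtTwo

namespace Summit.BirchSwinnertonDyer.BirchSwinnertonDyer.Theorems.SignedMuAtTwo

/-! ## §1. (G″)_N ⟹ an odd doubled plus period on a `4^k`-class, for a `T₂`-eigenform with even eigenvalue -/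

section HeckeKernel

variable {N : ℕ} [NeZero N] (f : CuspForm (Gamma0 N) 2)

/-- **The mod-2 plus character of a `T₂`-eigenform with EVEN eigenvalue is `T₂`-killed**: if `T₂ f = a f`, `a ∈ 2ℤ`, and
`δ₀, δ₁, δ'` is any translate family of `γ` (`{∞,γ∞}_{T₂ h} = {∞,δ₀∞}_h + {∞,δ₁∞}_h + {∞,δ'∞}_h` for every `h`), then the integers
`m(·) = 2 re{∞,·∞}_f/Ω⁺_f` satisfy `m(δ₀) + m(δ₁) + m(δ') = a·m(γ) ≡ 0 (mod 2)`. [cite: CremonaAlgorithms1997, §2.4, §2.8] -/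
theorem sum_re_cuspSymbol_translates_even (hΩ : plusPeriod f ≠ 0) {a : ℤ} (ha : Even a)
    (hT : heckeT (Gamma0 N) 2 2 f = (a : ℂ) • f) (m : Gamma0 N → ℤ)
    (hm : ∀ γ : Gamma0 N, (cuspSymbol f γ).re = m γ * (plusPeriod f / 2))
    (γ : Gamma0 N) (δ : Fin 2 → Gamma0 N) (δ' : Gamma0 N)
    (hδ : ∀ h : CuspForm (Gamma0 N) 2,
      cuspSymbol (heckeT (Gamma0 N) 2 2 h) γ = ∑ j : Fin 2, cuspSymbol h (δ j) + cuspSymbol h δ') :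
    ((∑ j : Fin 2, m (δ j) + m δ' : ℤ) : ZMod 2) = 0 := by
  have hsumf := hδ f
  rw [hT, cuspSymbol_smul] at hsumf
  have hre := congrArg Complex.re hsumf
  rw [show ((a : ℂ)) = ((a : ℝ) : ℂ) by norm_cast, Complex.re_ofReal_mul, hm γ, Complex.add_re, Complex.re_sum,
    hm δ'] at hre
  rw [Finset.sum_congr rfl fun j _ ↦ hm (δ j)] at hre
  have hint : a * m γ = ∑ j : Fin 2, m (δ j) + m δ' := by
    have h2 : plusPeriod f / 2 ≠ 0 := div_ne_zero hΩ two_ne_zero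
    have : ((a * m γ : ℤ) : ℝ) * (plusPeriod f / 2) = ((∑ j : Fin 2, m (δ j) + m δ' : ℤ) : ℝ) * (plusPeriod f / 2) := by
      push_cast; rw [add_mul, Finset.sum_mul, ← hre]; ring
    exact_mod_cast mul_right_cancel₀ h2 this
  rw [← hint]
  obtain ⟨t, rfl⟩ := ha
  push_cast
  rw [← two_mul, mul_assoc]
  exact mul_eq_zero_of_left (by decide) _

/-- **(R) under the MINIMAL hypothesis (G″)_N.** Let `f ∈ S₂(Γ₀(N))` with `Ω⁺_f ≠ 0` and `T₂ f = a f`, `a` EVEN. ASSUME (G″)_N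
(`hG`, inline): every `χ : Γ₀(N) → ZMod 2` that is additive, factors through the period functionals, is `T₂`-KILLED (for every `γ` and
every translate family `δ₀, δ₁, δ'` of `γ` the sum `χ δ₀ + χ δ₁ + χ δ'` vanishes) and kills every `γ` with `|d(γ)| = 4^k`, `k ≥ 1`, is
identically zero. THEN some `γ` with `|d(γ)| = 4^k`, `k ≥ 1`, has `2 re{∞,γ∞}_f/Ω⁺_f` ODD (else `χ_f` would satisfy all four and
vanish, contradicting `re{∞,γ∞}_f = Ω⁺_f/2` somewhere, `exists_re_cuspSymbol_eq_plusPeriod_half`). Homological reading of (G″)_N: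
`V^even_N + T₂ H₁(X₀(N);𝔽₂) = H₁(X₀(N);𝔽₂)`; it is implied by (G′)_N (`heckeKernelSpan_of_cuspSpan`).
[cite: Pollack2003, Conj. 6.3] [cite: CremonaAlgorithms1997, §2.4, §2.8] -/
theorem exists_odd_re_cuspSymbol_of_heckeKernelSpan (hΩ : plusPeriod f ≠ 0) {a : ℤ} (ha : Even a)
    (hT : heckeT (Gamma0 N) 2 2 f = (a : ℂ) • f)
    (hG : ∀ χ : Gamma0 N → ZMod 2,
      (∀ γ δ : Gamma0 N, χ (γ * δ) = χ γ + χ δ) →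
      (∀ γ δ : Gamma0 N, periodFunctional N γ = periodFunctional N δ → χ γ = χ δ) →
      (∀ (γ : Gamma0 N) (δ : Fin 2 → Gamma0 N) (δ' : Gamma0 N),
        (∀ h : CuspForm (Gamma0 N) 2,
          cuspSymbol (heckeT (Gamma0 N) 2 2 h) γ = ∑ j : Fin 2, cuspSymbol h (δ j) + cuspSymbol h δ') →
        ∑ j : Fin 2, χ (δ j) + χ δ' = 0) →
      (∀ γ : Gamma0 N, (∃ k : ℕ, 1 ≤ k ∧ ((γ : SL(2, ℤ)) 1 1).natAbs = 4 ^ k) → χ γ = 0) →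
      ∀ γ : Gamma0 N, χ γ = 0) :
    ∃ γ : Gamma0 N, (∃ k : ℕ, 1 ≤ k ∧ ((γ : SL(2, ℤ)) 1 1).natAbs = 4 ^ k) ∧
      ∃ m : ℤ, Odd m ∧ (cuspSymbol f γ).re = m * (plusPeriod f / 2) := by
  by_contra H
  push Not at H
  choose m hm using exists_int_re_cuspSymbol_eq f hΩ
  have hmul : ∀ γ δ : Gamma0 N, m (γ * δ) = m γ + m δ := by
    intro γ δ
    apply int_eq_of_mul_plusPeriod_half_eq f hΩ
    have h := cuspSymbol_mul_holds f γ δ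
    have := congrArg Complex.re h
    rw [Complex.add_re, hm, hm, hm] at this
    rw [this]; push_cast; ring
  have hfac : ∀ γ δ : Gamma0 N, periodFunctional N γ = periodFunctional N δ → m γ = m δ := by
    intro γ δ h
    apply int_eq_of_mul_plusPeriod_half_eq f hΩ
    rw [← hm, ← hm, ← periodFunctional_apply N γ f, ← periodFunctional_apply N δ f, h]
  have hkill : ∀ γ : Gamma0 N, (∃ k : ℕ, 1 ≤ k ∧ ((γ : SL(2, ℤ)) 1 1).natAbs = 4 ^ k) →
      ((m γ : ℤ) : ZMod 2) = 0 := by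
    intro γ hγ
    have hne := H γ hγ (m γ)
    have heven : Even (m γ) := by
      by_contra hodd
      exact hne (Int.not_even_iff_odd.mp hodd) (hm γ)
    obtain ⟨r, hr⟩ := heven
    rw [hr]; push_cast
    rw [← two_mul]
    exact mul_eq_zero_of_left (by decide) _
  have hker : ∀ (γ : Gamma0 N) (δ : Fin 2 → Gamma0 N) (δ' : Gamma0 N),
      (∀ h : CuspForm (Gamma0 N) 2,
        cuspSymbol (heckeT (Gamma0 N) 2 2 h) γ = ∑ j : Fin 2, cuspSymbol h (δ j) + cuspSymbol h δ') →
      ∑ j : Fin 2, ((m (δ j) : ℤ) : ZMod 2) + ((m δ' : ℤ) : ZMod 2) = 0 := by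
    intro γ δ δ' hδ
    have := sum_re_cuspSymbol_translates_even f hΩ ha hT m hm γ δ δ' hδ
    push_cast at this
    exact this
  have hzero := hG (fun γ ↦ ((m γ : ℤ) : ZMod 2)) (fun γ δ ↦ by simp only [hmul]; push_cast; rfl)
    (fun γ δ h ↦ by simp only [hfac γ δ h]) hker hkill
  obtain ⟨γ₀, hγ₀⟩ := exists_re_cuspSymbol_eq_plusPeriod_half f hΩ
  have h1 : m γ₀ = 1 := int_eq_of_mul_plusPeriod_half_eq f hΩ (by rw [← hm, hγ₀]; push_cast; ring)
  have := hzero γ₀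
  simp only [h1] at this
  exact absurd this (by decide)

/-! ## §2. (G′)_N ⟹ (G″)_N (odd `N`) -/

/-- **The structural hypothesis implies the minimal one**: for ODD `N`, (G′)_N (every character through the period homology
killing the `4^k`-loops is `ψ∘d`) implies (G″)_N (every such character which is moreover `T₂`-killed is `0`): by the Hecke–Shimura
lemma at `p = 2` (`exists_cuspSymbol_heckeT_lowerRight`: a translate family with `d(δ₀)d(δ₁)d(δ') = d(γ)³`) a `T₂`-killed `ψ∘d`
has `0 = ψ(d(γ)³) = 3ψ(d(γ)) = ψ(d(γ))` for every `γ`. [cite: LingOesterle1991, Thm. 6 (character form, p = 2)] -/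
theorem heckeKernelSpan_of_cuspSpan (h2N : ¬ 2 ∣ N)
    (hG : ∀ χ : Gamma0 N → ZMod 2,
      (∀ γ δ : Gamma0 N, χ (γ * δ) = χ γ + χ δ) →
      (∀ γ δ : Gamma0 N, periodFunctional N γ = periodFunctional N δ → χ γ = χ δ) →
      (∀ γ : Gamma0 N, (∃ k : ℕ, 1 ≤ k ∧ ((γ : SL(2, ℤ)) 1 1).natAbs = 4 ^ k) → χ γ = 0) →
      ∃ ψ : ZMod N → ZMod 2, (∀ x y : ZMod N, IsUnit x → IsUnit y → ψ (x * y) = ψ x + ψ y) ∧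
        ∀ γ : Gamma0 N, χ γ = ψ ((((γ : SL(2, ℤ)) 1 1 : ℤ) : ZMod N))) :
    ∀ χ : Gamma0 N → ZMod 2,
      (∀ γ δ : Gamma0 N, χ (γ * δ) = χ γ + χ δ) →
      (∀ γ δ : Gamma0 N, periodFunctional N γ = periodFunctional N δ → χ γ = χ δ) →
      (∀ (γ : Gamma0 N) (δ : Fin 2 → Gamma0 N) (δ' : Gamma0 N),
        (∀ h : CuspForm (Gamma0 N) 2,
          cuspSymbol (heckeT (Gamma0 N) 2 2 h) γ = ∑ j : Fin 2, cuspSymbol h (δ j) + cuspSymbol h δ') →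
        ∑ j : Fin 2, χ (δ j) + χ δ' = 0) →
      (∀ γ : Gamma0 N, (∃ k : ℕ, 1 ≤ k ∧ ((γ : SL(2, ℤ)) 1 1).natAbs = 4 ^ k) → χ γ = 0) →
      ∀ γ : Gamma0 N, χ γ = 0 := by
  intro χ hadd hfac hker hkill γ
  obtain ⟨ψ, hψ, hχψ⟩ := hG χ hadd hfac hkill
  obtain ⟨δ, δ', hsum, hprod⟩ := exists_cuspSymbol_heckeT_lowerRight (N := N) Nat.prime_two h2N γ
  have h0 := hker γ δ δ' hsum
  rw [hχψ δ', Finset.sum_congr rfl fun j _ ↦ hχψ (δ j),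
    ← map_prod_eq_sum_of_mul_on_units hψ _ _ fun j _ ↦ isUnit_gamma0_apply_one_one (δ j),
    ← hψ _ _ (Finset.prod_induction _ IsUnit (fun _ _ ↦ IsUnit.mul) isUnit_one
      fun j _ ↦ isUnit_gamma0_apply_one_one (δ j)) (isUnit_gamma0_apply_one_one δ'),
    hprod, map_pow_eq_smul_of_mul_on_units hψ (isUnit_gamma0_apply_one_one γ)] at h0
  -- `3 • ψ(d) = ψ(d)` in `ZMod 2`
  rw [hχψ γ]
  have h3 : (2 + 1) • ψ ((((γ : SL(2, ℤ)) 1 1 : ℤ) : ZMod N)) = ψ ((((γ : SL(2, ℤ)) 1 1 : ℤ) : ZMod N)) := by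
    rw [add_nsmul, one_nsmul, two_nsmul, ← two_mul, show (2 : ZMod 2) = 0 by decide, zero_mul, zero_add]
  rwa [h3] at h0

end HeckeKernel

/-! ## §3. (G″)_N ⟹ FLAT on the habitat⁺ -/

section Flat

variable {N : ℕ} [NeZero N] (f : CuspForm (Gamma0 N) 2)

/-- **(R), minimal hypothesis, Mazur–Tate indexing**: for a normalised newform with rational coefficients, ODD level and `a₂ = 0`,
(G″)_N gives a plus symbol `[5^s/2^{n+2}]⁺_f` (`n` even) of `2`-adic norm `≥ 2`.
[cite: Pollack2003, Conj. 6.3] [cite: MazurTateTeitelbaum1986Invent, §I.8, §I.13] -/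
theorem exists_two_le_norm_ratPlusSymbol_of_heckeKernelSpan (hf : IsNewform0 f) (hQ : coeffField f = ⊥)
    (h2N : ¬ 2 ∣ N) (ha₂ : cuspCoeff f 2 = 0)
    (hG : ∀ χ : Gamma0 N → ZMod 2,
      (∀ γ δ : Gamma0 N, χ (γ * δ) = χ γ + χ δ) →
      (∀ γ δ : Gamma0 N, periodFunctional N γ = periodFunctional N δ → χ γ = χ δ) →
      (∀ (γ : Gamma0 N) (δ : Fin 2 → Gamma0 N) (δ' : Gamma0 N),
        (∀ h : CuspForm (Gamma0 N) 2,
          cuspSymbol (heckeT (Gamma0 N) 2 2 h) γ = ∑ j : Fin 2, cuspSymbol h (δ j) + cuspSymbol h δ') →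
        ∑ j : Fin 2, χ (δ j) + χ δ' = 0) →
      (∀ γ : Gamma0 N, (∃ k : ℕ, 1 ≤ k ∧ ((γ : SL(2, ℤ)) 1 1).natAbs = 4 ^ k) → χ γ = 0) →
      ∀ γ : Gamma0 N, χ γ = 0) :
    ∃ n : ℕ, Even n ∧ ∃ s : ZMod (2 ^ n),
      2 ≤ ‖((ratPlusSymbol f ((((cyclotomicGenerator 2 : ZMod (2 ^ (n + 2))) ^ s.val).val : ℚ) /
        (2 : ℚ) ^ (n + 2)) : ℚ) : ℚ_[2])‖ := by
  have hΩ : plusPeriod f ≠ 0 := (IsNewform0.plusPeriod_pos_holds hf hQ).ne'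
  have hT : heckeT (Gamma0 N) 2 2 f = ((0 : ℤ) : ℂ) • f := by
    rw [IsNewform0.heckeT_eq_coeff_smul hf Nat.prime_two]
    change cuspCoeff f 2 • f = _
    rw [ha₂]; simp
  obtain ⟨γ, ⟨k, hk1, hk⟩, m, hmo, hm⟩ :=
    exists_odd_re_cuspSymbol_of_heckeKernelSpan f hΩ (a := 0) ⟨0, rfl⟩ hT hG
  have hd : ((γ : SL(2, ℤ)) 1 1).natAbs = 2 ^ ((2 * k - 2) + 2) := by
    rw [hk, show (4 : ℕ) = 2 ^ 2 by norm_num, ← pow_mul]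
    congr 1; omega
  have hd0 : (γ : SL(2, ℤ)) 1 1 ≠ 0 := by
    intro h0
    rw [h0, Int.natAbs_zero] at hk
    exact absurd hk.symm (pow_ne_zero k (by norm_num))
  have heven : Even ((γ : SL(2, ℤ)) 1 1) := by
    have h2 : (2 : ℤ) ∣ (γ : SL(2, ℤ)) 1 1 := by
      rw [← Int.natAbs_dvd_natAbs, hk]
      change 2 ∣ 4 ^ k
      exact dvd_pow (by norm_num) (by omega)
    exact even_iff_two_dvd.mpr h2
  have hb : Odd ((γ : SL(2, ℤ)) 0 1) := odd_apply_zero_one_of_even _ heven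
  obtain ⟨s, hs⟩ := exists_ratPlusSymbol_pow_cyclotomicGenerator_eq f hb (2 * k - 2) hd
  refine ⟨2 * k - 2, ⟨k - 1, by omega⟩, s, ?_⟩
  rw [hs, norm_ratPlusSymbol_eq_two_of_odd f hf hQ h2N ha₂ γ hd0 hmo hm]

variable {W : WeierstrassCurve ℚ} [W.IsElliptic] [W.IsGloballyMinimal]

/-- **THEOREM (R), minimal form, on the habitat⁺: (G″)_{N_W} ⟹ FLAT at `(W, f)`.** For `W/ℚ` good supersingular at `2` with
`a₂(W) = 0` and its newform `f`: if no non-zero `T₂`-killed additive `ZMod 2`-character of `Γ₀(N_W)` through the period homology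
vanishes on all `γ` with `|d(γ)| = 4^k`, `k ≥ 1` (the inline hypothesis (G″)_{N_W}; homologically `V^even + T₂H₁ = H₁(X₀(N_W);𝔽₂)`),
then `2 ∤ L♭` for every Pollack pair `(L♯, L♭)` of `f` at `2`. Weaker hypothesis than `flatAtTwo_of_cuspSpan`'s (G′)_{N_W}
(`heckeKernelSpan_of_cuspSpan`). BSD is not proved by this. [cite: Pollack2003, Conj. 6.3 and Prop. 6.18] -/
theorem flatAtTwo_of_heckeKernelSpan [NeZero (W.conductorNorm ℤ)] {f : CuspForm (Gamma0 (W.conductorNorm ℤ)) 2}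
    (hf : IsNewformOf W f) (hss : GoodSS W 2) (ha : W.frobeniusTrace 2 = 0)
    (hG : ∀ χ : Gamma0 (W.conductorNorm ℤ) → ZMod 2,
      (∀ γ δ : Gamma0 (W.conductorNorm ℤ), χ (γ * δ) = χ γ + χ δ) →
      (∀ γ δ : Gamma0 (W.conductorNorm ℤ),
        periodFunctional (W.conductorNorm ℤ) γ = periodFunctional (W.conductorNorm ℤ) δ → χ γ = χ δ) →
      (∀ (γ : Gamma0 (W.conductorNorm ℤ)) (δ : Fin 2 → Gamma0 (W.conductorNorm ℤ)) (δ' : Gamma0 (W.conductorNorm ℤ)),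
        (∀ h : CuspForm (Gamma0 (W.conductorNorm ℤ)) 2,
          cuspSymbol (heckeT (Gamma0 (W.conductorNorm ℤ)) 2 2 h) γ =
            ∑ j : Fin 2, cuspSymbol h (δ j) + cuspSymbol h δ') →
        ∑ j : Fin 2, χ (δ j) + χ δ' = 0) →
      (∀ γ : Gamma0 (W.conductorNorm ℤ), (∃ k : ℕ, 1 ≤ k ∧ ((γ : SL(2, ℤ)) 1 1).natAbs = 4 ^ k) → χ γ = 0) →
      ∀ γ : Gamma0 (W.conductorNorm ℤ), χ γ = 0) :
    ∀ Lplus Lminus : IwasawaAlgebra 2, IsPollackPair f 2 Lplus Lminus → ¬ PowerSeries.C (2 : ℤ_[2]) ∣ Lminus := by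
  have h2N : ¬ 2 ∣ W.conductorNorm ℤ := not_two_dvd_conductorNorm_of_goodSS hss
  have ha₂ : cuspCoeff f 2 = 0 := by
    rw [hf.2 2, W.LFunction_apply_prime_eq_frobeniusTrace 2 hss.1, ha]; simp
  obtain ⟨n, hn, s, hs⟩ :=
    exists_two_le_norm_ratPlusSymbol_of_heckeKernelSpan f hf.1 hf.coeffField_eq_bot h2N ha₂ hG
  exact flatAtTwo_of_two_le_norm_ratPlusSymbol hn hs

/-- **(G″)_N for every odd `N` ⟹ the registered stub `FlatMuZeroAtTwo`** (verbatim). BSD is not proved by this.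
[cite: Pollack2003, Conj. 6.3 and Prop. 6.18] -/
theorem flatMuZeroAtTwo_of_heckeKernelSpan
    (hG : ∀ (N : ℕ) [NeZero N], ¬ 2 ∣ N → ∀ χ : Gamma0 N → ZMod 2,
      (∀ γ δ : Gamma0 N, χ (γ * δ) = χ γ + χ δ) →
      (∀ γ δ : Gamma0 N, periodFunctional N γ = periodFunctional N δ → χ γ = χ δ) →
      (∀ (γ : Gamma0 N) (δ : Fin 2 → Gamma0 N) (δ' : Gamma0 N),
        (∀ h : CuspForm (Gamma0 N) 2,
          cuspSymbol (heckeT (Gamma0 N) 2 2 h) γ = ∑ j : Fin 2, cuspSymbol h (δ j) + cuspSymbol h δ') →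
        ∑ j : Fin 2, χ (δ j) + χ δ' = 0) →
      (∀ γ : Gamma0 N, (∃ k : ℕ, 1 ≤ k ∧ ((γ : SL(2, ℤ)) 1 1).natAbs = 4 ^ k) → χ γ = 0) →
      ∀ γ : Gamma0 N, χ γ = 0) :
    ∀ (W : WeierstrassCurve ℚ) [W.IsElliptic] [W.IsGloballyMinimal], ¬ W.HasCM → W.analyticRank = 0 →
      GoodSS W 2 → W.frobeniusTrace 2 = 0 → W.Δ < 0 →
      ∀ [NeZero (W.conductorNorm ℤ)] (f : CuspForm (Gamma0 (W.conductorNorm ℤ)) 2), IsNewformOf W f →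
      ∀ (Lplus Lminus : IwasawaAlgebra 2), IsPollackPair f 2 Lplus Lminus → ¬ PowerSeries.C (2 : ℤ_[2]) ∣ Lminus :=
  fun W _ _ _ _ hss ha _ _ _f hf ↦
    flatAtTwo_of_heckeKernelSpan hf hss ha (hG (W.conductorNorm ℤ) (not_two_dvd_conductorNorm_of_goodSS hss))

end Flat

end Summit.BirchSwinnertonDyer.BirchSwinnertonDyer.Theorems.SignedMuAtTwo

end
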